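import Summits.CriticalPhenomena.CardyFormulaZ2.Theorems.CardySusyWardDiscretisationFamilyExistsColumns
import HarnessLib

/-!
# Selection of a clean non-degenerate cut edge, I: resolution of an east-degenerate column — helper for `DiscretisationFamilyExists` (stmt-CriticalPhenomena-9644)

Coordinates of `Mesh.cell`; the cross-cut descends the column `J` (cells `(J, j)`, `j ≤ R`) through
CLEAN cells (inner, top side not a chord) down to the cell `(J, y)` whose bottom side
`[(J, y), (J+1, y)]` is a face-boundary edge (`(J, y-1)` not inner).  If that edge is DEGENERATE
with the small site at its east end (`δ + r (J+1, y) ≤ r (J, y)`, `r = infDist · ∂Ω`), it cannot be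
the cut (`…ExistsFarPole`), and `resolve_degII` finds instead, within columns `J … J+2` and rows
`≤ e' + 4` (`e'` the event row of column `J+1`), one of three CLEAN CROSSINGS with a
NON-degenerate face-boundary edge: (C1) a straight crossing at the bottom of column `J+1`;
(C2E) a "wide L": from column `J` east through the inner cell `(J+1, h)` (side `x = J+1` not a
chord) across the vertical face-boundary edge `x = J+2` of row `h`; (C3E) a "hook": from column
`J+1` east to `(J+2, h+1)`, south to `(J+2, h)` (both inner, sides not chords), across the bottom of
`(J+2, h)`.  The case analysis is the one written out in the session notes (feet of degenerate
pairs lie on open lattice segments, which forbids both adjacent cells to be inner; partners are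
unique; successor edges are non-degenerate).
-/

noncomputable section

open Set Metric Complex
open Literature.Probability.LatticeModels Literature.Probability.Percolation
  Literature.Probability.LatticeModels.Mesh Literature.Probability.LatticeModels.DiscreteDobrushin

namespace Summit.CriticalPhenomena.CardyFormulaZ2.Theorems.DiscretisationFamilyExists

/-- **Resolution of an east-degenerate column.** See the module docstring. Hypotheses: column `J`
clean on rows `y … R`, `(J, y-1)` not inner, the bottom edge degenerate with small east end;
`e'` is the event row of column `J+1` (rows above it clean up to `R`, itself not clean), with room
`e' + 4 ≤ R`. [folklore] -/
theorem resolve_degII {E : DiscreteDobrushin} (hΩ : IsOpen E.Ω)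
    (hJE : frontier E.Ω ⊆ closure (closure E.Ω)ᶜ) (hext : IsConnected (closure E.Ω)ᶜ)
    (hunb : ¬ Bornology.IsBounded (closure E.Ω)ᶜ) (hδ : 0 < E.δ) (hne : (frontier E.Ω).Nonempty)
    {J y R e' : ℤ} (hyR : y ≤ R)
    (hJ : (∀ j : ℤ, y ≤ j → j ≤ R → (E.IsInnerFace ![J, j] ∧ ¬ (((![J, j + 1] : Site 2) ∈ E.zdBoundary) ∧ ((![J + 1, j + 1] : Site 2) ∈ E.zdBoundary)))))
    (hg : ¬ E.IsInnerFace ![J, y - 1])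
    (hdeg : E.δ + infDist (meshPoint E.δ ![J + 1, y]) (frontier E.Ω) ≤ infDist (meshPoint E.δ ![J, y]) (frontier E.Ω))
    (he'R : e' + 4 ≤ R)
    (hJ1 : ∀ j : ℤ, e' < j → j ≤ R → (E.IsInnerFace ![J + 1, j] ∧ ¬ (((![J + 1, j + 1] : Site 2) ∈ E.zdBoundary) ∧ ((![J + 2, j + 1] : Site 2) ∈ E.zdBoundary))))
    (hX : ¬ (E.IsInnerFace ![J + 1, e'] ∧ ¬ (((![J + 1, e' + 1] : Site 2) ∈ E.zdBoundary) ∧ ((![J + 2, e' + 1] : Site 2) ∈ E.zdBoundary)))) :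
    (∃ y' : ℤ, ((∀ j : ℤ, y' ≤ j → j ≤ R → (E.IsInnerFace ![J + 1, j] ∧ ¬ (((![J + 1, j + 1] : Site 2) ∈ E.zdBoundary) ∧ ((![J + 2, j + 1] : Site 2) ∈ E.zdBoundary)))) ∧ y' ≤ R ∧ ¬ E.IsInnerFace ![J + 1, y' - 1] ∧ (¬ (E.δ + infDist (meshPoint E.δ ![J + 1, y']) (frontier E.Ω) ≤ infDist (meshPoint E.δ ![J + 2, y']) (frontier E.Ω)) ∧ ¬ (E.δ + infDist (meshPoint E.δ ![J + 2, y']) (frontier E.Ω) ≤ infDist (meshPoint E.δ ![J + 1, y']) (frontier E.Ω))))) ∨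
    (∃ h : ℤ, ((∀ j : ℤ, y ≤ j → j ≤ R → (E.IsInnerFace ![J, j] ∧ ¬ (((![J, j + 1] : Site 2) ∈ E.zdBoundary) ∧ ((![J + 1, j + 1] : Site 2) ∈ E.zdBoundary)))) ∧ y ≤ h ∧ h ≤ R ∧ E.IsInnerFace ![J + 1, h] ∧ ¬ (((![J + 1, h] : Site 2) ∈ E.zdBoundary) ∧ ((![J + 1, h + 1] : Site 2) ∈ E.zdBoundary)) ∧ ¬ E.IsInnerFace ![J + 2, h] ∧ (¬ (E.δ + infDist (meshPoint E.δ ![J + 2, h]) (frontier E.Ω) ≤ infDist (meshPoint E.δ ![J + 2, h + 1]) (frontier E.Ω)) ∧ ¬ (E.δ + infDist (meshPoint E.δ ![J + 2, h + 1]) (frontier E.Ω) ≤ infDist (meshPoint E.δ ![J + 2, h]) (frontier E.Ω))))) ∨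
    (∃ h : ℤ, ((∀ j : ℤ, e' + 1 ≤ j → j ≤ R → (E.IsInnerFace ![J + 1, j] ∧ ¬ (((![J + 1, j + 1] : Site 2) ∈ E.zdBoundary) ∧ ((![J + 2, j + 1] : Site 2) ∈ E.zdBoundary)))) ∧ e' + 1 ≤ h + 1 ∧ h + 1 ≤ R ∧ E.IsInnerFace ![J + 2, h + 1] ∧ E.IsInnerFace ![J + 2, h] ∧ ¬ (((![J + 2, h + 1] : Site 2) ∈ E.zdBoundary) ∧ ((![J + 2, h + 2] : Site 2) ∈ E.zdBoundary)) ∧ ¬ (((![J + 2, h + 1] : Site 2) ∈ E.zdBoundary) ∧ ((![J + 3, h + 1] : Site 2) ∈ E.zdBoundary)) ∧ ¬ E.IsInnerFace ![J + 2, h - 1] ∧ (¬ (E.δ + infDist (meshPoint E.δ ![J + 2, h]) (frontier E.Ω) ≤ infDist (meshPoint E.δ ![J + 3, h]) (frontier E.Ω)) ∧ ¬ (E.δ + infDist (meshPoint E.δ ![J + 3, h]) (frontier E.Ω) ≤ infDist (meshPoint E.δ ![J + 2, h]) (frontier E.Ω))))) := by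
  set δ := E.δ with hδdef
  have hregs := And.intro hΩ (And.intro hJE (And.intro hext hunb))
  -- the small site `v = (J+1, y)` and the big site `u = (J, y)`
  have hσ : E.IsInnerFace ![J, y] := (hJ y le_rfl hyR).1
  obtain ⟨huB, hvB⟩ := mem_zdBoundary_of_inner_not_inner_below hσ hg
  have hdeg0 : δ + infDist (meshPoint δ (![J, y] + cornerUnit 0)) (frontier E.Ω) ≤
      infDist (meshPoint δ ![J, y]) (frontier E.Ω) := by rw [vec_add_cornerUnit_zero]; exact hdeg
  obtain ⟨hvpos, hvlt⟩ := infDist_pos_lt_of_degenerate hΩ hδ huB 0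
    (by rw [vec_add_cornerUnit_zero]; exact hvB) hdeg0
  rw [vec_add_cornerUnit_zero] at hvpos hvlt
  -- the foot of `v` lies on the open side between `(J+1, y-1)` and `(J+1, y)`
  obtain ⟨f, hf, hfd⟩ := exists_foot hne (meshPoint δ ![J + 1, y])
  have hfeq := foot_east_degenerate hδ J y hdeg hf hfd.symm
  have hnb : ¬ (E.IsInnerFace ![J + 1, y - 1] ∧ E.IsInnerFace ![J + 1, y]) := by
    refine not_both_inner_of_frontier_h hΩ hJE hext hunb hδ (k := J + 1) (j₀ := y) hf ?_ ?_
    · rw [hfeq]; constructor <;> push_cast <;> nlinarith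
    · rw [hfeq]
  -- hence the event row of column `J+1` is at least `y - 1`
  have he'y : y - 1 ≤ e' := by
    by_contra hlt
    push Not at hlt
    exact hnb ⟨(hJ1 (y - 1) (by omega) (by omega)).1, (hJ1 y (by omega) hyR).1⟩
  rcases eq_or_lt_of_le he'y with he | he
  · ----------------------------------------------------------------
    -- Case A: `e' = y - 1`: straight crossing at the bottom of column `J+1`
    have hσ' : E.IsInnerFace ![J + 1, y] := (hJ1 y (by omega) hyR).1
    have hg' : ¬ E.IsInnerFace ![J + 1, y - 1] := fun h => hnb ⟨h, hσ'⟩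
    have hnd := not_degenerate_of_foot_mem_openSegment (Ω := E.Ω) hδ ![J + 1, y] 0
      (t := infDist (meshPoint δ ![J + 1, y]) (frontier E.Ω) / δ) (div_pos hvpos hδ)
      ((div_lt_one hδ).2 hvlt) ?_ (by rw [div_mul_cancel₀ _ hδ.ne'])
    swap
    · convert hf using 1
      rw [hfeq, meshPoint_vec']
      apply Complex.ext
      · simp [cornerUnit, meshPoint, Site.toComplex]; field_simp
      · simp [cornerUnit, meshPoint, Site.toComplex]
    rw [vec_add_cornerUnit_zero] at hnd
    refine Or.inl ⟨y, fun j hj hjR => hJ1 j (by omega) hjR, hyR, hg', ?_⟩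
    simpa [show J + 1 + 1 = J + 2 by ring] using hnd
  · ----------------------------------------------------------------
    -- Case B: `y ≤ e'`; the obstacle `X = (J+1, e')` is not inner
    have hXi : ¬ E.IsInnerFace ![J + 1, e'] := by
      intro hXi
      apply hX
      refine ⟨hXi, fun hch => ?_⟩
      -- `(J+1, e'+1)` would have four inner cells
      refine not_mem_zdBoundary_of_four (E := E) (J + 1) (e' + 1) (hJ1 (e' + 1) (by omega) (by omega)).1
        ?_ ?_ ?_ hch.1
      · simpa using (hJ (e' + 1) (by omega) (by omega)).1
      · simpa using (hJ e' (by omega) (by omega)).1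
      · simpa using hXi
    have hw1i : E.IsInnerFace ![J + 1, e' + 1] := (hJ1 (e' + 1) (by omega) (by omega)).1
    obtain ⟨hw1B, hw2B⟩ := mem_zdBoundary_of_inner_not_inner_below (k := J + 1) (j := e' + 1) hw1i (by simpa using hXi)
    rw [show J + 1 + 1 = J + 2 by ring] at hw2B
    -- the site `(J+1, e'+2)` is not a boundary site (four clean cells)
    have hw1up : (![J + 1, e' + 2] : Site 2) ∉ E.zdBoundary := by
      refine not_mem_zdBoundary_of_four (E := E) (J + 1) (e' + 2) (hJ1 (e' + 2) (by omega) (by omega)).1 ?_ ?_ ?_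
      · simpa using (hJ (e' + 2) (by omega) (by omega)).1
      · have := (hJ (e' + 1) (by omega) (by omega)).1
        simpa [show e' + 2 - 1 = e' + 1 by ring] using this
      · simpa [show e' + 2 - 1 = e' + 1 by ring] using hw1i
    by_cases hnd : (¬ (δ + infDist (meshPoint δ ![J + 1, e' + 1]) (frontier E.Ω) ≤
        infDist (meshPoint δ ![J + 2, e' + 1]) (frontier E.Ω)) ∧
      ¬ (δ + infDist (meshPoint δ ![J + 2, e' + 1]) (frontier E.Ω) ≤
        infDist (meshPoint δ ![J + 1, e' + 1]) (frontier E.Ω)))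
    · -- C1 at the bottom of column `J+1`, row `e'+1`
      refine Or.inl ⟨e' + 1, fun j hj hjR => hJ1 j (by omega) hjR, by omega, by simpa using hXi, ?_⟩
      simpa [show J + 1 + 1 = J + 2 by ring] using hnd
    -- the edge `[w₁, w₂]` is degenerate; a west foot of `w₁` is impossible
    have hdeg2 : δ + infDist (meshPoint δ ![J + 2, e' + 1]) (frontier E.Ω) ≤
        infDist (meshPoint δ ![J + 1, e' + 1]) (frontier E.Ω) := by
      by_contra hB
      have hA : δ + infDist (meshPoint δ ![J + 1, e' + 1]) (frontier E.Ω) ≤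
          infDist (meshPoint δ ![J + 2, e' + 1]) (frontier E.Ω) := by
        by_contra hA; exact hnd ⟨hA, hB⟩
      -- the foot of `w₁` is on the open segment between `(J, e')` and `(J, e'+1)`, both inner
      have hw1pos : 0 < infDist (meshPoint δ ![J + 1, e' + 1]) (frontier E.Ω) :=
        infDist_frontier_pos hΩ hδ hw1B
      have hw1lt : infDist (meshPoint δ ![J + 1, e' + 1]) (frontier E.Ω) < δ := by
        have := infDist_frontier_le_sqrt_two hΩ hδ hw2B
        have h2 : Real.sqrt 2 < 2 := by
          rw [show (2:ℝ) = Real.sqrt (2 ^ 2) by rw [Real.sqrt_sq (by norm_num)]]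
          exact Real.sqrt_lt_sqrt (by norm_num) (by norm_num)
        nlinarith
      obtain ⟨f₁, hf₁, hf₁d⟩ := exists_foot hne (meshPoint δ ![J + 1, e' + 1])
      have hf₁eq := foot_west_degenerate hδ (J + 1) (e' + 1) (by
        rw [show J + 1 + 1 = J + 2 by ring]; exact hA) hf₁ hf₁d.symm
      refine not_both_inner_of_frontier_h hΩ hJE hext hunb hδ (k := J) (j₀ := e' + 1) hf₁ ?_ ?_ ⟨?_, ?_⟩
      · rw [hf₁eq]; constructor <;> push_cast <;> nlinarith
      · rw [hf₁eq]
      · simpa using (hJ e' (by omega) (by omega)).1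
      · exact (hJ (e' + 1) (by omega) (by omega)).1
    -- so `w₂ = (J+2, e'+1)` is small with an east foot
    have hdeg2' : δ + infDist (meshPoint δ (![J + 1, e' + 1] + cornerUnit 0)) (frontier E.Ω) ≤
        infDist (meshPoint δ ![J + 1, e' + 1]) (frontier E.Ω) := by
      rw [vec_add_cornerUnit_zero, show J + 1 + 1 = J + 2 by ring]; exact hdeg2
    obtain ⟨hw2pos, hw2lt⟩ := infDist_pos_lt_of_degenerate hΩ hδ hw1B 0
      (by rw [vec_add_cornerUnit_zero, show J + 1 + 1 = J + 2 by ring]; exact hw2B) hdeg2'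
    rw [vec_add_cornerUnit_zero, show J + 1 + 1 = J + 2 by ring] at hw2pos hw2lt
    obtain ⟨f₂, hf₂, hf₂d⟩ := exists_foot hne (meshPoint δ ![J + 2, e' + 1])
    have hf₂eq := foot_east_degenerate hδ (J + 1) (e' + 1) (by
      rw [show J + 1 + 1 = J + 2 by ring]; exact hdeg2) hf₂ (by
      rw [show J + 1 + 1 = J + 2 by ring]; exact hf₂d.symm)
    rw [show J + 1 + 1 = J + 2 by ring] at hf₂eq
    have hnb2 : ¬ (E.IsInnerFace ![J + 2, e' + 1 - 1] ∧ E.IsInnerFace ![J + 2, e' + 1]) := by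
      refine not_both_inner_of_frontier_h hΩ hJE hext hunb hδ (k := J + 2) (j₀ := e' + 1) hf₂ ?_ ?_
      · rw [hf₂eq]; constructor <;> push_cast <;> nlinarith
      · rw [hf₂eq]
    rw [show e' + 1 - 1 = e' by ring] at hnb2
    -- the successor / perpendicular edges at `w₂` are non-degenerate
    have hperp := not_degenerate_perp_of_degenerate (Ω := E.Ω) hδ hne ![J + 1, e' + 1] 0 1 (by decide)
      (by rw [vec_add_cornerUnit_zero, show J + 1 + 1 = J + 2 by ring]; exact hw2pos)
      (by rw [vec_add_cornerUnit_zero, show J + 1 + 1 = J + 2 by ring]; exact hw2lt) hdeg2'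
    rw [vec_add_cornerUnit_zero, show J + 1 + 1 = J + 2 by ring, vec_add_cornerUnit_one] at hperp
    have hsucc := not_degenerate_succ_of_degenerate (Ω := E.Ω) hδ hne ![J + 1, e' + 1] 0
      (by rw [vec_add_cornerUnit_zero, show J + 1 + 1 = J + 2 by ring]; exact hw2pos)
      (by rw [vec_add_cornerUnit_zero, show J + 1 + 1 = J + 2 by ring]; exact hw2lt) hdeg2'
    rw [vec_add_cornerUnit_zero, show J + 1 + 1 = J + 2 by ring, vec_add_cornerUnit_zero,
      show J + 2 + 1 = J + 3 by ring] at hsucc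
    by_cases hB1 : E.IsInnerFace ![J + 2, e' + 1]
    swap
    · -- Sub-case B1: `(J+2, e'+1)` not inner ⇒ wide L from column `J` at row `e'+1`
      refine Or.inr (Or.inl ⟨e' + 1, hJ, by omega, by omega, hw1i, fun h => hw1up ?_, hB1, ?_⟩)
      · simpa [show e' + 1 + 1 = e' + 2 by ring] using h.2
      · simpa [show e' + 1 + 1 = e' + 2 by ring] using hperp
    -- Sub-case B2: `(J+2, e'+1)` inner, hence `(J+2, e')` is not
    have hB2 : ¬ E.IsInnerFace ![J + 2, e'] := fun h => hnb2 ⟨h, hB1⟩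
    -- the site `(J+2, e'+2)` is not a boundary site if `(J+2, e'+2)` is inner
    by_cases hC : E.IsInnerFace ![J + 2, e' + 2]
    · -- Sub-sub-case B2a: hook from column `J+1`
      have hw2up : (![J + 2, e' + 2] : Site 2) ∉ E.zdBoundary := by
        refine not_mem_zdBoundary_of_four (E := E) (J + 2) (e' + 2) hC ?_ ?_ ?_
        · simpa [show J + 2 - 1 = J + 1 by ring] using (hJ1 (e' + 2) (by omega) (by omega)).1
        · simpa [show J + 2 - 1 = J + 1 by ring, show e' + 2 - 1 = e' + 1 by ring] using hw1i
        · simpa [show e' + 2 - 1 = e' + 1 by ring] using hB1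
      refine Or.inr (Or.inr ⟨e' + 1, fun j hj hjR => hJ1 j (by omega) hjR, by omega, by omega, ?_, hB1,
        fun h => hw2up ?_, fun h => hw2up ?_, by simpa using hB2, hsucc⟩)
      · simpa [show e' + 1 + 1 = e' + 2 by ring] using hC
      · simpa [show e' + 1 + 1 = e' + 2 by ring] using h.1
      · simpa [show e' + 1 + 1 = e' + 2 by ring] using h.1
    · -- Sub-sub-case B2b: `(J+2, e'+2)` not inner: wide L at row `e'+2` or `e'+3`
      have hw3i : E.IsInnerFace ![J + 1, e' + 2] := (hJ1 (e' + 2) (by omega) (by omega)).1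
      obtain ⟨hw3B, hw4B⟩ := mem_zdBoundary_of_inner_not_inner_right (k := J + 1) (j := e' + 2) hw3i
        (by simpa [show J + 1 + 1 = J + 2 by ring] using hC)
      rw [show J + 1 + 1 = J + 2 by ring] at hw3B hw4B
      rw [show e' + 2 + 1 = e' + 3 by ring] at hw4B
      have hw1up' : (![J + 1, e' + 3] : Site 2) ∉ E.zdBoundary := by
        refine not_mem_zdBoundary_of_four (E := E) (J + 1) (e' + 3) (hJ1 (e' + 3) (by omega) (by omega)).1 ?_ ?_ ?_
        · simpa using (hJ (e' + 3) (by omega) (by omega)).1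
        · have := (hJ (e' + 2) (by omega) (by omega)).1
          simpa [show e' + 3 - 1 = e' + 2 by ring] using this
        · simpa [show e' + 3 - 1 = e' + 2 by ring] using hw3i
      by_cases hnd3 : (¬ (δ + infDist (meshPoint δ ![J + 2, e' + 2]) (frontier E.Ω) ≤
          infDist (meshPoint δ ![J + 2, e' + 3]) (frontier E.Ω)) ∧
        ¬ (δ + infDist (meshPoint δ ![J + 2, e' + 3]) (frontier E.Ω) ≤
          infDist (meshPoint δ ![J + 2, e' + 2]) (frontier E.Ω)))
      · -- wide L from column `J` at row `e'+2`
        refine Or.inr (Or.inl ⟨e' + 2, hJ, by omega, by omega, hw3i, fun h => hw1up' ?_, hC, ?_⟩)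
        · simpa [show e' + 2 + 1 = e' + 3 by ring] using h.2
        · simpa [show e' + 2 + 1 = e' + 3 by ring] using hnd3
      -- degenerate vertical edge `[w₃, w₄]`; a south foot of `w₃` is impossible
      have hdeg4 : δ + infDist (meshPoint δ ![J + 2, e' + 3]) (frontier E.Ω) ≤
          infDist (meshPoint δ ![J + 2, e' + 2]) (frontier E.Ω) := by
        by_contra hB'
        have hA' : δ + infDist (meshPoint δ ![J + 2, e' + 2]) (frontier E.Ω) ≤
            infDist (meshPoint δ ![J + 2, e' + 3]) (frontier E.Ω) := by
          by_contra hA'; exact hnd3 ⟨hA', hB'⟩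
        have hw3pos : 0 < infDist (meshPoint δ ![J + 2, e' + 2]) (frontier E.Ω) :=
          infDist_frontier_pos hΩ hδ hw3B
        have hw3lt : infDist (meshPoint δ ![J + 2, e' + 2]) (frontier E.Ω) < δ := by
          have := infDist_frontier_le_sqrt_two hΩ hδ hw4B
          have h2 : Real.sqrt 2 < 2 := by
            rw [show (2:ℝ) = Real.sqrt (2 ^ 2) by rw [Real.sqrt_sq (by norm_num)]]
            exact Real.sqrt_lt_sqrt (by norm_num) (by norm_num)
          nlinarith
        obtain ⟨f₃, hf₃, hf₃d⟩ := exists_foot hne (meshPoint δ ![J + 2, e' + 2])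
        have hf₃eq := foot_south_degenerate hδ (J + 2) (e' + 2) (by
          rw [show e' + 2 + 1 = e' + 3 by ring]; exact hA') hf₃ hf₃d.symm
        refine not_both_inner_of_frontier_v hΩ hJE hext hunb hδ (k₀ := J + 2) (j := e' + 1) hf₃ ?_ ?_ ⟨?_, hB1⟩
        · rw [hf₃eq]
        · rw [hf₃eq]; constructor <;> push_cast <;> nlinarith
        · simpa [show J + 2 - 1 = J + 1 by ring] using hw1i
      -- so `w₄ = (J+2, e'+3)` is small with a north foot, on the side between `(J+1, e'+3)` and `(J+2, e'+3)`
      have hdeg4' : δ + infDist (meshPoint δ (![J + 2, e' + 2] + cornerUnit 1)) (frontier E.Ω) ≤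
          infDist (meshPoint δ ![J + 2, e' + 2]) (frontier E.Ω) := by
        rw [vec_add_cornerUnit_one, show e' + 2 + 1 = e' + 3 by ring]; exact hdeg4
      obtain ⟨hw4pos, hw4lt⟩ := infDist_pos_lt_of_degenerate hΩ hδ hw3B 1
        (by rw [vec_add_cornerUnit_one, show e' + 2 + 1 = e' + 3 by ring]; exact hw4B) hdeg4'
      rw [vec_add_cornerUnit_one, show e' + 2 + 1 = e' + 3 by ring] at hw4pos hw4lt
      obtain ⟨f₄, hf₄, hf₄d⟩ := exists_foot hne (meshPoint δ ![J + 2, e' + 3])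
      have hf₄eq := foot_north_degenerate hδ (J + 2) (e' + 2) (by
        rw [show e' + 2 + 1 = e' + 3 by ring]; exact hdeg4) hf₄ (by
        rw [show e' + 2 + 1 = e' + 3 by ring]; exact hf₄d.symm)
      rw [show e' + 2 + 1 = e' + 3 by ring] at hf₄eq
      have hD : ¬ E.IsInnerFace ![J + 2, e' + 3] := by
        intro hD
        refine not_both_inner_of_frontier_v hΩ hJE hext hunb hδ (k₀ := J + 2) (j := e' + 3) hf₄ ?_ ?_ ⟨?_, hD⟩
        · rw [hf₄eq]
        · rw [hf₄eq]; constructor <;> push_cast <;> nlinarith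
        · simpa [show J + 2 - 1 = J + 1 by ring] using (hJ1 (e' + 3) (by omega) (by omega)).1
      have hsucc4 := not_degenerate_succ_of_degenerate (Ω := E.Ω) hδ hne ![J + 2, e' + 2] 1
        (by rw [vec_add_cornerUnit_one, show e' + 2 + 1 = e' + 3 by ring]; exact hw4pos)
        (by rw [vec_add_cornerUnit_one, show e' + 2 + 1 = e' + 3 by ring]; exact hw4lt) hdeg4'
      rw [vec_add_cornerUnit_one, show e' + 2 + 1 = e' + 3 by ring, vec_add_cornerUnit_one,
        show e' + 3 + 1 = e' + 4 by ring] at hsucc4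
      -- wide L from column `J` at row `e'+3`
      have hw5i : E.IsInnerFace ![J + 1, e' + 3] := (hJ1 (e' + 3) (by omega) (by omega)).1
      have hw1up'' : (![J + 1, e' + 4] : Site 2) ∉ E.zdBoundary := by
        refine not_mem_zdBoundary_of_four (E := E) (J + 1) (e' + 4) (hJ1 (e' + 4) (by omega) (by omega)).1 ?_ ?_ ?_
        · simpa using (hJ (e' + 4) (by omega) (by omega)).1
        · have := (hJ (e' + 3) (by omega) (by omega)).1
          simpa [show e' + 4 - 1 = e' + 3 by ring] using this
        · simpa [show e' + 4 - 1 = e' + 3 by ring] using hw5i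
      refine Or.inr (Or.inl ⟨e' + 3, hJ, by omega, by omega, hw5i, fun h => hw1up'' ?_, hD, ?_⟩)
      · simpa [show e' + 3 + 1 = e' + 4 by ring] using h.2
      · simpa [show e' + 3 + 1 = e' + 4 by ring] using hsucc4

/-- **No west-degenerate site next to two inner cells.** If the cells `(K, j-1)` and `(K, j)` are
inner and `w₁ = (K+1, j)`, `w₂ = (K+2, j)` are boundary sites, then `w₁` is not degenerate with
`w₂` (its foot would be the point `(δ(K+1) - r w₁, δ j)` of the open segment between the two inner
cells). [folklore] -/
theorem not_degenerate_west_of_inner {E : DiscreteDobrushin} (hΩ : IsOpen E.Ω)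
    (hJE : frontier E.Ω ⊆ closure (closure E.Ω)ᶜ) (hext : IsConnected (closure E.Ω)ᶜ)
    (hunb : ¬ Bornology.IsBounded (closure E.Ω)ᶜ) (hδ : 0 < E.δ) (hne : (frontier E.Ω).Nonempty)
    {K j : ℤ} (h₁ : E.IsInnerFace ![K, j - 1]) (h₂ : E.IsInnerFace ![K, j])
    (hw₁ : ((![K + 1, j] : Site 2) ∈ E.zdBoundary)) (hw₂ : ((![K + 2, j] : Site 2) ∈ E.zdBoundary)) :
    ¬ (E.δ + infDist (meshPoint E.δ ![K + 1, j]) (frontier E.Ω) ≤ infDist (meshPoint E.δ ![K + 2, j]) (frontier E.Ω)) := by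
  intro hA
  have hpos : 0 < infDist (meshPoint E.δ ![K + 1, j]) (frontier E.Ω) := infDist_frontier_pos hΩ hδ hw₁
  have hlt : infDist (meshPoint E.δ ![K + 1, j]) (frontier E.Ω) < E.δ := by
    have := infDist_frontier_le_sqrt_two hΩ hδ hw₂
    have h2 : Real.sqrt 2 < 2 := by
      rw [show (2:ℝ) = Real.sqrt (2 ^ 2) by rw [Real.sqrt_sq (by norm_num)]]
      exact Real.sqrt_lt_sqrt (by norm_num) (by norm_num)
    nlinarith
  obtain ⟨f, hf, hfd⟩ := exists_foot hne (meshPoint E.δ ![K + 1, j])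
  have hfeq := foot_west_degenerate hδ (K + 1) j (by
    rw [show K + 1 + 1 = K + 2 by ring]; exact hA) hf hfd.symm
  refine not_both_inner_of_frontier_h hΩ hJE hext hunb hδ (k := K) (j₀ := j) hf ?_ ?_ ⟨h₁, h₂⟩
  · rw [hfeq]; constructor <;> push_cast <;> nlinarith
  · rw [hfeq]

end Summit.CriticalPhenomena.CardyFormulaZ2.Theorems.DiscretisationFamilyExists

end
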